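import Mathlib
import Summits.ValiantsHypothesis.ValiantsHypothesis.Theorems.NewtonUnitEquationsDissociatedFixedKExposedWord
import Summits.ValiantsHypothesis.ValiantsHypothesis.Theorems.TwoProducts.Negative.FirstOrderExposure
import Summits.ValiantsHypothesis.ValiantsHypothesis.Theorems.NewtonFramesTwoProductsFrameRungTwoClassHull
import Summits.ValiantsHypothesis.ValiantsHypothesis.Theorems.NewtonFramesTwoProductsFrameRungTwoFaceCount

/-!
# Crux `TwoProducts` (stmt-5906), line `FrameRungTwo`: the rung CONTAINS the symmetric-difference bound (calibration)

Registered forward line `Cruxes/TwoProducts/Lines/FrameRungTwo.lean`: rung `FrameRungTwo` = `k` products of `m` bivariate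
polynomials drawn from TWO dissociated frames have `≤ (m t + 2)^{C(k)}` Newton vertices; it stands modulo its OPEN core
`stub_crossCancelCount` (stubs `stub_classHull` p579112, `stub_faceCount` p580655 landed, composition `FrameRungTwo_of`
kernel-checked in the line file).

This file is a CALIBRATION CERTIFICATE for refuters and planners: the rung (its statement taken verbatim as hypothesis `h`)
implies a statement with NO ALGEBRA LEFT — the **all-ones design**.  Put coefficient `1` on every letter of frame `A` and
`-1` on one factor of frame `B`: then `Π_j (Σ_{α ∈ A_j} X^α) − Π_j (Σ_{β ∈ B_j} X^β)` has support EXACTLY the symmetric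
difference `S_A ∆ S_B` of the two sumsets (`support_allOnes`, by dissociation every point of a sumset is hit once), so the
rung at `k = 2` gives

  `SymmDiff bound`: `∃ C, ∀ m t (A B : Fin m → Finset ℕ²)` dissociated with `#A_j, #B_j ≤ t`,
  `#vert conv(S_A ∆ S_B) ≤ (m t + 2)^C`  (`symmDiff_bound_of_frameRungTwo`).

Consequently a family of PAIRS OF DISSOCIATED FRAMES whose sumsets' symmetric difference has super-polynomially (in `m t`)
many hull vertices refutes the rung and hence (the other two stubs being theorems) the open stub `stub_crossCancelCount`.
Geometry alone does not decide it (a dissociated digit sumset contains convex chains of length exponential in `m`, crux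
notes Framework VII-G); what must be decided is whether TWO dissociated systems can coincide exactly below a long convex
chain of non-common points — a finite, two-dimensional Cobham/de Bruijn-type rigidity question (1-D shadow: complementing
systems `{0,1}⊕{0,2,4} = {0,1,2}⊕{0,3}`).  Small-case search (hill-climb, `m ≤ 8`, `t ≤ 4`; base-2 vs base-3 digit frames)
finds at most `≈ 2 m t` vertices.  Nothing here bears on the crux `TwoProducts` itself or on `VP ≠ VNP`.
[folklore; setting KPTT arXiv:1308.2286 §2, §5]
-/

set_option linter.dupNamespace false

namespace Summit.ValiantsHypothesis.ValiantsHypothesis.Theorems.NewtonFramesTwoProducts.FrameRungTwoSymmDiff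

open MvPolynomial
open scoped BigOperators symmDiff
open Summit.ValiantsHypothesis.ValiantsHypothesis.Theorems.DissociatedFixedK.Negative (emb)

noncomputable section

/-! ## The all-ones design: supports -/

/-- The indicator polynomial `Σ_{α ∈ S} X^α` of a finite exponent set has support inside `S`. [folklore] -/
theorem support_sum_monomial_subset (S : Finset (Fin 2 →₀ ℕ)) :
    (∑ α ∈ S, monomial α (1 : ℂ)).support ⊆ S := by
  intro e he
  obtain ⟨α, hα, heα⟩ := Finset.mem_biUnion.mp (support_sum he)
  have := support_monomial_subset heα
  rw [Finset.mem_singleton] at this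
  exact this ▸ hα

/-- Coefficients of the indicator polynomial: `1` on `S`, `0` off `S`. [folklore] -/
theorem coeff_sum_monomial (S : Finset (Fin 2 →₀ ℕ)) (e : Fin 2 →₀ ℕ) :
    coeff e (∑ α ∈ S, monomial α (1 : ℂ)) = if e ∈ S then 1 else 0 := by
  classical
  rw [coeff_sum]
  simp_rw [coeff_monomial]
  rw [Finset.sum_ite_eq']

/-- **All-ones product on a dissociated frame.**  The coefficient of `X^e` in `Π_j (Σ_{α ∈ A_j} X^α)` is `1` if `e` lies
in the sumset `S_A = {Σ_j a_j : a ∈ Π_j A_j}` and `0` otherwise (each point of a dissociated sumset is hit exactly once).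
[folklore] -/
theorem coeff_prod_allOnes {m : ℕ} (A : Fin m → Finset (Fin 2 →₀ ℕ))
    (hinj : ∀ a b : Fin m → (Fin 2 →₀ ℕ), (∀ j, a j ∈ A j) → (∀ j, b j ∈ A j) →
      ∑ j, a j = ∑ j, b j → a = b) (e : Fin 2 →₀ ℕ) :
    coeff e (∏ j, ∑ α ∈ A j, monomial α (1 : ℂ)) =
      if e ∈ (Fintype.piFinset A).image (fun a => ∑ j, a j) then 1 else 0 := by
  classical
  have hsupp : ∀ j, (∑ α ∈ A j, monomial α (1 : ℂ)).support ⊆ A j := fun j => support_sum_monomial_subset (A j)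
  by_cases he : e ∈ (Fintype.piFinset A).image (fun a => ∑ j, a j)
  · rw [if_pos he]
    obtain ⟨a, ha, rfl⟩ := Finset.mem_image.mp he
    have ha' : ∀ j, a j ∈ A j := Fintype.mem_piFinset.mp ha
    have h := Summit.ValiantsHypothesis.Theorems.DissociatedFixedK.coeff_sum_prod_of_dissociated A
      (fun _ : Fin 1 => fun j => ∑ α ∈ A j, monomial α (1 : ℂ)) (fun _ j => hsupp j) hinj a ha'
    simp only [Finset.univ_unique, Finset.sum_singleton] at h
    rw [h]
    refine Finset.prod_eq_one fun j _ => ?_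
    rw [coeff_sum_monomial, if_pos (ha' j)]
  · rw [if_neg he]
    by_contra hne
    have hmem : e ∈ (∑ _i : Fin 1, ∏ j, ∑ α ∈ A j, monomial α (1 : ℂ)).support := by
      rw [Finset.univ_unique, Finset.sum_singleton]
      exact mem_support_iff.mpr hne
    obtain ⟨a, ha, hae, -⟩ :=
      Summit.ValiantsHypothesis.Theorems.DissociatedFixedK.exists_word_of_mem_support A
        (fun _ : Fin 1 => fun j => ∑ α ∈ A j, monomial α (1 : ℂ)) (fun _ j => hsupp j) hinj hmem
    exact he (Finset.mem_image.mpr ⟨a, Fintype.mem_piFinset.mpr ha, hae⟩)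

/-- **Support of the all-ones design** `Π_j 𝟙_{A_j} − Π_j 𝟙_{B_j}` on two dissociated frames: exactly the symmetric
difference `S_A ∆ S_B` of the two sumsets. [folklore] -/
theorem support_allOnes {m : ℕ} (A B : Fin m → Finset (Fin 2 →₀ ℕ))
    (hA : ∀ a b : Fin m → (Fin 2 →₀ ℕ), (∀ j, a j ∈ A j) → (∀ j, b j ∈ A j) → ∑ j, a j = ∑ j, b j → a = b)
    (hB : ∀ a b : Fin m → (Fin 2 →₀ ℕ), (∀ j, a j ∈ B j) → (∀ j, b j ∈ B j) → ∑ j, a j = ∑ j, b j → a = b) :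
    ((∏ j, ∑ α ∈ A j, monomial α (1 : ℂ)) - ∏ j, ∑ β ∈ B j, monomial β (1 : ℂ)).support =
      ((Fintype.piFinset A).image (fun a => ∑ j, a j)) ∆ ((Fintype.piFinset B).image (fun b => ∑ j, b j)) := by
  classical
  ext e
  rw [mem_support_iff, coeff_sub, coeff_prod_allOnes A hA, coeff_prod_allOnes B hB, Finset.mem_symmDiff]
  by_cases h1 : e ∈ (Fintype.piFinset A).image (fun a => ∑ j, a j) <;>
    by_cases h2 : e ∈ (Fintype.piFinset B).image (fun b => ∑ j, b j) <;>
    simp [h1, h2]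

/-! ## The certificate -/

/-- **The rung `FrameRungTwo` contains the symmetric-difference bound.**  Hypothesis `h` is the statement of
`Cruxes/TwoProducts/Lines/FrameRungTwo.lean :: FrameRungTwo` (= `FrameRung 2`) verbatim, with `emb` the route's embedding
`ℕ² → ℝ²`.  Conclusion: for every pair of dissociated frames `A, B` (`m` coordinates, `≤ t` letters each) the convex hull of
the symmetric difference of the two sumsets has `≤ (m t + 2)^C` vertices, `C = C(2)` of the rung.  Instance used: `k = 2`,
classes `c = id`, the all-ones design with the sign `−1` carried by factor `0` of frame `B` (`m = 0` is trivial: both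
sumsets are `{0}`). [folklore] -/
theorem symmDiff_bound_of_frameRungTwo
    (h : ∀ k : ℕ, ∃ C : ℕ, ∀ (m t : ℕ) (A : Fin 2 → Fin m → Finset (Fin 2 →₀ ℕ)) (c : Fin k → Fin 2)
      (f : Fin k → Fin m → MvPolynomial (Fin 2) ℂ),
      (∀ σ j, (A σ j).card ≤ t) →
      (∀ i j, (f i j).support ⊆ A (c i) j) →
      (∀ σ, ∀ a b : Fin m → (Fin 2 →₀ ℕ), (∀ j, a j ∈ A σ j) → (∀ j, b j ∈ A σ j) →
          ∑ j, a j = ∑ j, b j → a = b) →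
      (Set.extremePoints ℝ (convexHull ℝ (emb '' ((∑ i, ∏ j, f i j).support : Set (Fin 2 →₀ ℕ))))).ncard
        ≤ (m * t + 2) ^ C) :
    ∃ C : ℕ, ∀ (m t : ℕ) (A B : Fin m → Finset (Fin 2 →₀ ℕ)),
      (∀ j, (A j).card ≤ t) → (∀ j, (B j).card ≤ t) →
      (∀ a b : Fin m → (Fin 2 →₀ ℕ), (∀ j, a j ∈ A j) → (∀ j, b j ∈ A j) → ∑ j, a j = ∑ j, b j → a = b) →
      (∀ a b : Fin m → (Fin 2 →₀ ℕ), (∀ j, a j ∈ B j) → (∀ j, b j ∈ B j) → ∑ j, a j = ∑ j, b j → a = b) →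
      (Set.extremePoints ℝ (convexHull ℝ (emb ''
        ↑(((Fintype.piFinset A).image (fun a => ∑ j, a j)) ∆ ((Fintype.piFinset B).image (fun b => ∑ j, b j)))))).ncard
        ≤ (m * t + 2) ^ C := by
  classical
  obtain ⟨K, hK⟩ := h 2
  refine ⟨K, fun m t A B hAt hBt hA hB => ?_⟩
  rcases Nat.eq_zero_or_pos m with hm | hm
  · -- `m = 0`: both sumsets are `{0}`, the symmetric difference is empty
    subst hm
    have h0 : ((Fintype.piFinset A).image (fun a => ∑ j, a j)) ∆ ((Fintype.piFinset B).image (fun b => ∑ j, b j))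
        = ∅ := by
      have e0 : ∀ A' : Fin 0 → Finset (Fin 2 →₀ ℕ), (Fintype.piFinset A').image (fun a => ∑ j, a j) = {0} := by
        intro A'
        refine Finset.eq_singleton_iff_unique_mem.mpr ⟨?_, ?_⟩
        · exact Finset.mem_image.mpr
            ⟨fun j => Fin.elim0 j, Fintype.mem_piFinset.mpr (fun j => Fin.elim0 j), by simp⟩
        · intro e he
          obtain ⟨a, -, rfl⟩ := Finset.mem_image.mp he
          simp
      have e1 := e0 A
      have e2 := e0 B
      rw [e1, e2, symmDiff_self]
      rfl
    rw [h0, Finset.coe_empty, Set.image_empty, convexHull_empty]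
    simp
  · -- `m ≥ 1`: the all-ones design, sign on factor `0` of frame `B`
    set j₀ : Fin m := ⟨0, hm⟩ with hj₀
    set PA : Fin m → MvPolynomial (Fin 2) ℂ := fun j => ∑ α ∈ A j, monomial α (1 : ℂ) with hPA
    set QB : Fin m → MvPolynomial (Fin 2) ℂ := fun j => ∑ β ∈ B j, monomial β (1 : ℂ) with hQB
    set s : Fin m → ℂ := fun j => if j = j₀ then -1 else 1 with hs
    set A2 : Fin 2 → Fin m → Finset (Fin 2 →₀ ℕ) := fun σ => if σ = 0 then A else B with hA2
    set f : Fin 2 → Fin m → MvPolynomial (Fin 2) ℂ :=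
      fun σ j => if σ = 0 then PA j else C (s j) * QB j with hf
    have h10 : (1 : Fin 2) ≠ 0 := by decide
    -- the rung's hypotheses for this instance
    have hcard : ∀ σ j, (A2 σ j).card ≤ t := by
      intro σ j
      by_cases hσ : σ = 0
      · simp only [hA2, hσ, if_true]; exact hAt j
      · simp only [hA2, hσ, if_false]; exact hBt j
    have hsupp : ∀ i j, (f i j).support ⊆ A2 ((fun i : Fin 2 => i) i) j := by
      intro i j
      by_cases hi : i = 0
      · simp only [hf, hA2, hi, if_true]
        exact support_sum_monomial_subset (A j)
      · simp only [hf, hA2, hi, if_false]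
        intro e he
        rw [mem_support_iff, coeff_C_mul] at he
        have hq : coeff e (QB j) ≠ 0 := fun h0 => he (by rw [h0, mul_zero])
        exact support_sum_monomial_subset (B j) (mem_support_iff.mpr hq)
    have hinj : ∀ σ, ∀ a b : Fin m → (Fin 2 →₀ ℕ), (∀ j, a j ∈ A2 σ j) → (∀ j, b j ∈ A2 σ j) →
        ∑ j, a j = ∑ j, b j → a = b := by
      intro σ
      by_cases hσ : σ = 0
      · simp only [hA2, hσ, if_true]; exact hA
      · simp only [hA2, hσ, if_false]; exact hB
    have key := hK m t A2 (fun i => i) f hcard hsupp hinj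
    -- the sum of the two products is the all-ones design
    have hprodB : ∏ j, f 1 j = -∏ j, QB j := by
      have e1 : ∀ j, f 1 j = C (s j) * QB j := fun j => by simp only [hf, h10, if_false]
      simp_rw [e1]
      rw [Finset.prod_mul_distrib, ← map_prod C]
      have hsprod : ∏ j, s j = -1 := by
        simp only [hs]
        rw [Finset.prod_ite_eq']
        simp
      rw [hsprod, map_neg, map_one, neg_one_mul]
    have hsum : (∑ i, ∏ j, f i j) = (∏ j, PA j) - ∏ j, QB j := by
      rw [Fin.sum_univ_two, hprodB, ← sub_eq_add_neg]
      simp only [hf, if_true]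
    rw [hsum, support_allOnes A B hA hB] at key
    exact key

/-! ## The open stub alone implies the bound

With `stub_classHull` (p579112) and `stub_faceCount` (p580655) theorems of the tree, the rung follows from the open stub by
the line file's composition `FrameRungTwo_of` (reproduced here, since `Cruxes/` files are not importable), so the
symmetric-difference bound is a consequence of `stub_crossCancelCount` ALONE. -/

/-- Splitting a `Fin k`-indexed sum along a `Fin 2`-valued colouring (as in the line file). [folklore] -/
theorem sum_split_fin_two {k : ℕ} {M : Type*} [AddCommMonoid M] (c : Fin k → Fin 2) (g : Fin k → M) :
    ∑ i, g i = (∑ i ∈ Finset.univ.filter (fun i => c i = 0), g i) +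
               (∑ i ∈ Finset.univ.filter (fun i => c i = 1), g i) := by
  have key : ∀ x : Fin 2, (¬ x = 0) ↔ x = 1 := by decide
  rw [← Finset.sum_filter_add_sum_filter_not Finset.univ (fun i => c i = 0)]
  congr 1
  refine Finset.sum_congr ?_ (fun _ _ => rfl)
  ext i
  simp only [Finset.mem_filter, Finset.mem_univ, true_and, key]

/-- Elementary arithmetic for the final count (as in the line file). [folklore] -/
theorem count_arith (x C₁ C₂ : ℕ) (hx : 2 ≤ x) :
    2 * (x ^ C₁ + x ^ C₁) + x ^ C₂ ≤ x ^ (C₁ + C₂ + 3) := by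
  have h4 : 4 ≤ x ^ 2 := by nlinarith
  have hx1 : 1 ≤ x := by omega
  calc 2 * (x ^ C₁ + x ^ C₁) + x ^ C₂ = 4 * x ^ C₁ + x ^ C₂ := by ring
    _ ≤ x ^ 2 * x ^ C₁ + x ^ C₂ := by gcongr
    _ ≤ x ^ (C₁ + C₂ + 2) + x ^ (C₁ + C₂ + 2) := by
        apply Nat.add_le_add
        · rw [← pow_add]; exact Nat.pow_le_pow_right hx1 (by omega)
        · exact Nat.pow_le_pow_right hx1 (by omega)
    _ = 2 * x ^ (C₁ + C₂ + 2) := by ring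
    _ ≤ x * x ^ (C₁ + C₂ + 2) := Nat.mul_le_mul_right _ hx
    _ = x ^ (C₁ + C₂ + 3) := by ring

/-- **The rung from the open stub** (the line file's `FrameRungTwo_of` fed with the landed `stub_classHull` and
`stub_faceCount`): hypothesis `h₃` is the registered `stub_crossCancelCount` VERBATIM; conclusion = the rung
`FrameRungTwo` (with `C = C₁ + C₂ + 3`).  Every vertex is strictly exposed by some functional
(`TwoProducts.Negative.exists_strict_exposing_of_finite`); it is cross-free (counted by `stub_faceCount` on the class hulls of
`stub_classHull`) or cross-cancelling (counted by `h₃`). [folklore] -/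
theorem frameRungTwo_of_crossCancelCount
    (h₃ : ∀ k : ℕ, ∃ C : ℕ, ∀ (m t : ℕ) (A : Fin 2 → Fin m → Finset (Fin 2 →₀ ℕ))
      (c : Fin k → Fin 2) (f : Fin k → Fin m → MvPolynomial (Fin 2) ℂ),
      (∀ σ j, (A σ j).card ≤ t) →
      (∀ i j, (f i j).support ⊆ A (c i) j) →
      (∀ σ, ∀ a b : Fin m → (Fin 2 →₀ ℕ), (∀ j, a j ∈ A σ j) → (∀ j, b j ∈ A σ j) →
          ∑ j, a j = ∑ j, b j → a = b) →
      {p : Fin 2 → ℝ | p ∈ Set.extremePoints ℝ (convexHull ℝ (emb ''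
            ((∑ i, ∏ j, f i j).support : Set (Fin 2 →₀ ℕ)))) ∧
          ∃ l : (Fin 2 → ℝ) →ₗ[ℝ] ℝ,
            (∀ q ∈ emb '' ((∑ i, ∏ j, f i j).support : Set (Fin 2 →₀ ℕ)), q ≠ p → l q < l p) ∧
            ∃ q ∈ emb '' ((∑ i ∈ Finset.univ.filter (fun i => c i = 0), ∏ j, f i j).support
                            : Set (Fin 2 →₀ ℕ)) ∪
                   emb '' ((∑ i ∈ Finset.univ.filter (fun i => c i = 1), ∏ j, f i j).support
                            : Set (Fin 2 →₀ ℕ)),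
              l p < l q}.ncard ≤ (m * t + 2) ^ C) :
    ∀ k : ℕ, ∃ C : ℕ, ∀ (m t : ℕ) (A : Fin 2 → Fin m → Finset (Fin 2 →₀ ℕ)) (c : Fin k → Fin 2)
      (f : Fin k → Fin m → MvPolynomial (Fin 2) ℂ),
      (∀ σ j, (A σ j).card ≤ t) →
      (∀ i j, (f i j).support ⊆ A (c i) j) →
      (∀ σ, ∀ a b : Fin m → (Fin 2 →₀ ℕ), (∀ j, a j ∈ A σ j) → (∀ j, b j ∈ A σ j) →
          ∑ j, a j = ∑ j, b j → a = b) →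
      (Set.extremePoints ℝ (convexHull ℝ (emb '' ((∑ i, ∏ j, f i j).support : Set (Fin 2 →₀ ℕ))))).ncard
        ≤ (m * t + 2) ^ C := by
  intro k
  obtain ⟨C₁, hC₁⟩ := FrameRungTwoClassHull.stub_classHull k
  obtain ⟨C₂, hC₂⟩ := h₃ k
  refine ⟨C₁ + C₂ + 3, ?_⟩
  intro m t A c f hA hf hinj
  have hcls := hC₁ m t A c f hA hf hinj
  have hcross := hC₂ m t A c f hA hf hinj
  set F : MvPolynomial (Fin 2) ℂ := ∑ i, ∏ j, f i j with hF
  set F₀ : MvPolynomial (Fin 2) ℂ := ∑ i ∈ Finset.univ.filter (fun i => c i = 0), ∏ j, f i j with hF₀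
  set F₁ : MvPolynomial (Fin 2) ℂ := ∑ i ∈ Finset.univ.filter (fun i => c i = 1), ∏ j, f i j with hF₁
  set X : Set (Fin 2 → ℝ) := emb '' (F.support : Set (Fin 2 →₀ ℕ)) with hX
  set Y₀ : Set (Fin 2 → ℝ) := emb '' (F₀.support : Set (Fin 2 →₀ ℕ)) with hY₀
  set Y₁ : Set (Fin 2 → ℝ) := emb '' (F₁.support : Set (Fin 2 →₀ ℕ)) with hY₁
  have hXfin : X.Finite := F.support.finite_toSet.image emb
  have hY₀fin : Y₀.Finite := F₀.support.finite_toSet.image emb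
  have hY₁fin : Y₁.Finite := F₁.support.finite_toSet.image emb
  have hsplit : F = F₀ + F₁ := sum_split_fin_two c (fun i => ∏ j, f i j)
  have hXY : X ⊆ Y₀ ∪ Y₁ := by
    intro q hq
    obtain ⟨e, he, rfl⟩ := hq
    have he' : e ∈ (F₀ + F₁).support := by rw [← hsplit]; exact he
    rcases Finset.mem_union.1 (MvPolynomial.support_add he') with h0 | h1
    · exact Or.inl ⟨e, h0, rfl⟩
    · exact Or.inr ⟨e, h1, rfl⟩
  have hface := FrameRungTwoFaceCount.stub_faceCount X Y₀ Y₁ hXfin hY₀fin hY₁fin hXY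
  set V : Set (Fin 2 → ℝ) := Set.extremePoints ℝ (convexHull ℝ X) with hV
  set Pfree : Set (Fin 2 → ℝ) := {p : Fin 2 → ℝ | p ∈ V ∧
      ∃ l : (Fin 2 → ℝ) →ₗ[ℝ] ℝ, (∀ q ∈ X, q ≠ p → l q < l p) ∧ (∀ q ∈ Y₀ ∪ Y₁, l q ≤ l p)} with hPfree
  set Pcross : Set (Fin 2 → ℝ) := {p : Fin 2 → ℝ | p ∈ V ∧
      ∃ l : (Fin 2 → ℝ) →ₗ[ℝ] ℝ, (∀ q ∈ X, q ≠ p → l q < l p) ∧ ∃ q ∈ Y₀ ∪ Y₁, l p < l q} with hPcross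
  have hVsub : V ⊆ Pfree ∪ Pcross := by
    intro p hp
    obtain ⟨l, hl⟩ :=
      Summit.ValiantsHypothesis.ValiantsHypothesis.Theorems.TwoProducts.Negative.exists_strict_exposing_of_finite
        hXfin hp
    by_cases hall : ∀ q ∈ Y₀ ∪ Y₁, l q ≤ l p
    · exact Or.inl ⟨hp, l, hl, hall⟩
    · push Not at hall
      obtain ⟨q, hq, hlt⟩ := hall
      exact Or.inr ⟨hp, l, hl, q, hq, hlt⟩
  have hVfin : V.Finite := hXfin.subset extremePoints_convexHull_subset
  have hPfin : (Pfree ∪ Pcross).Finite :=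
    hVfin.subset (Set.union_subset (fun p hp => hp.1) (fun p hp => hp.1))
  have hx : 2 ≤ m * t + 2 := by omega
  calc V.ncard ≤ (Pfree ∪ Pcross).ncard := Set.ncard_le_ncard hVsub hPfin
    _ ≤ Pfree.ncard + Pcross.ncard := Set.ncard_union_le _ _
    _ ≤ 2 * ((Set.extremePoints ℝ (convexHull ℝ Y₀)).ncard
            + (Set.extremePoints ℝ (convexHull ℝ Y₁)).ncard) + (m * t + 2) ^ C₂ :=
        Nat.add_le_add hface hcross
    _ ≤ 2 * ((m * t + 2) ^ C₁ + (m * t + 2) ^ C₁) + (m * t + 2) ^ C₂ := by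
        gcongr
        · exact hcls 0
        · exact hcls 1
    _ ≤ (m * t + 2) ^ (C₁ + C₂ + 3) := count_arith _ _ _ hx

/-- **Refuter's target for the open stub.**  `stub_crossCancelCount` (hypothesis `h₃`, verbatim) implies the
symmetric-difference bound for every pair of dissociated frames: a super-polynomial family of
`#vert conv(S_A ∆ S_B)` refutes the stub. [folklore] -/
theorem symmDiff_bound_of_crossCancelCount
    (h₃ : ∀ k : ℕ, ∃ C : ℕ, ∀ (m t : ℕ) (A : Fin 2 → Fin m → Finset (Fin 2 →₀ ℕ))
      (c : Fin k → Fin 2) (f : Fin k → Fin m → MvPolynomial (Fin 2) ℂ),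
      (∀ σ j, (A σ j).card ≤ t) →
      (∀ i j, (f i j).support ⊆ A (c i) j) →
      (∀ σ, ∀ a b : Fin m → (Fin 2 →₀ ℕ), (∀ j, a j ∈ A σ j) → (∀ j, b j ∈ A σ j) →
          ∑ j, a j = ∑ j, b j → a = b) →
      {p : Fin 2 → ℝ | p ∈ Set.extremePoints ℝ (convexHull ℝ (emb ''
            ((∑ i, ∏ j, f i j).support : Set (Fin 2 →₀ ℕ)))) ∧
          ∃ l : (Fin 2 → ℝ) →ₗ[ℝ] ℝ,
            (∀ q ∈ emb '' ((∑ i, ∏ j, f i j).support : Set (Fin 2 →₀ ℕ)), q ≠ p → l q < l p) ∧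
            ∃ q ∈ emb '' ((∑ i ∈ Finset.univ.filter (fun i => c i = 0), ∏ j, f i j).support
                            : Set (Fin 2 →₀ ℕ)) ∪
                   emb '' ((∑ i ∈ Finset.univ.filter (fun i => c i = 1), ∏ j, f i j).support
                            : Set (Fin 2 →₀ ℕ)),
              l p < l q}.ncard ≤ (m * t + 2) ^ C) :
    ∃ C : ℕ, ∀ (m t : ℕ) (A B : Fin m → Finset (Fin 2 →₀ ℕ)),
      (∀ j, (A j).card ≤ t) → (∀ j, (B j).card ≤ t) →
      (∀ a b : Fin m → (Fin 2 →₀ ℕ), (∀ j, a j ∈ A j) → (∀ j, b j ∈ A j) → ∑ j, a j = ∑ j, b j → a = b) →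
      (∀ a b : Fin m → (Fin 2 →₀ ℕ), (∀ j, a j ∈ B j) → (∀ j, b j ∈ B j) → ∑ j, a j = ∑ j, b j → a = b) →
      (Set.extremePoints ℝ (convexHull ℝ (emb ''
        ↑(((Fintype.piFinset A).image (fun a => ∑ j, a j)) ∆ ((Fintype.piFinset B).image (fun b => ∑ j, b j)))))).ncard
        ≤ (m * t + 2) ^ C :=
  symmDiff_bound_of_frameRungTwo (frameRungTwo_of_crossCancelCount h₃)

end

end Summit.ValiantsHypothesis.ValiantsHypothesis.Theorems.NewtonFramesTwoProducts.FrameRungTwoSymmDiff
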